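import Summits.QuantumFields.BalabanUV.Beta.CovariantFluxTorus
import Summits.QuantumFields.BalabanUV.Beta.CovariantLaplacianGauge
import Summits.QuantumFields.BalabanUV.Beta.MultiscaleGradientSource

/-!
# `Summit.QuantumFields.BalabanUV.Beta.CovariantGradientBox` — THE BOX-LEVEL COVARIANT GRADIENT ESTIMATE FOR ROUGH BOND MATRICES IN A
# GOOD GAUGE: the flat interior estimate (FG) ⟹ `‖(D_R f)(x₀,μ)‖ ≤ |c₀|·[√|Cp|·(K₁M/(R+1) + K₂(R+1)·G′/c₀²) + εM]`,
# `G′ = G + 2d|c₀|·ε·D₁ + c₀²d(γ + ε²)·M` — the LOCAL inequality of road P3's reduction «rough-`Rm` gradient member ⇐ (FG) + sup member +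
# ONE (3.35)-shaped binder (SF)» (module 4, claim «COVARIANT-FLAT-SPLIT»; modules 1–3: `CovariantLaplacianFlatSplit`,
# `CovariantLaplacianGauge`, `ScaleBootstrap`, `CovariantFluxTorus`)

HONEST FRAMING (page 1 of everything in this cell).  Discharging `FlowStep.BetaPertH` would make Bałaban's ultraviolet
stability UNCONDITIONAL — a constructive-QFT result; it is NOT the continuum limit and NOT the Clay problem.  This module
discharges nothing of `BetaPertH`; it is [folklore] finite-dimensional bookkeeping about the torus MODEL, kernel-checked, by CO-OWNER #3 of
binder row D4 (unit `b2b-balaban-beta-d4-p3`, road P3 «reduction road», gen 13).  HONEST DEPENDENCY: continuum YM on T⁴ ⇐ BetaPertH ∧ nine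
spine estimates (0/9 proved); BetaPertH ⇐ (D1) ∧ (D4) ∧ CAP+tail; G-an2-4 gates asym, D1 and NE2/3/4.

THE POINT.  The owner's file 19b (`MultiscaleGradientMember`) gives the gradient member (3.42)₂'s shape for `levelOp` with FLAT transport
modulo the flat Poisson interior gradient binder (FG) (co-owner beta-d4-p2's GR3 shape: «`|w| ≤ M`, `|W·w − Nw| ≤ G` on `dist(·,x₀) ≤ 2R+2`
⟹ `|w(x₀+e_μ) − w(x₀)| ≤ K₁M/(R+1) + K₂(R+1)G/c₀²`»); for ROUGH column-orthonormal `Rm` there is no level-free pointwise gradient member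
at MODEL level without a small-field input (owner's census E-an4-141d).  THIS FILE is the box-level inequality that carries the small-field
input: on the unit torus `UT N` (any `d`), constant weight `c ≡ c₀ ≠ 0`, column-orthonormal `Rm`, a field `f`, a centre `x₀` and `R ≥ 1`,
write `B = {dist(·,x₀) ≤ 2R+2}`; GIVEN a gauge `g` (sitewise column-orthonormal, transformed objects `f^g`, `R^g` by hypothesis as in
module 2) whose transporters are NEAR `1` around the box — DEVIATION `‖(R^g_b − 1)v‖ ≤ ε‖v‖` for bonds starting in `{dist(·,x₀) ≤ 2R+3}`,
LATTICE GRADIENT `‖(R^g_{(x−e_μ,μ)} − R^g_{(x,μ)})v‖ ≤ γ‖v‖` for `x ∈ B` — (the (SF) datum AT THIS BOX: [B9] (3.35)'s `|A|`, `|∇A|` in the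
cube's gauge), (FG) at `(x₀, R)` for scalar functions, and the bounds `‖f‖ ≤ M`, `‖D_R*D_R f‖ ≤ G` on `B`, `‖D_R f‖ ≤ D₁` on the bonds
starting in `{dist ≤ 2R+3}` (fibre norms — gauge invariant), THEN for every axis `μ`:
  **`‖(D_R f)((x₀,μ),·)‖ ≤ |c₀|·( √|Cp|·( K₁·M/(R+1) + K₂·(R+1)·(G + 2d|c₀|·ε·D₁ + c₀²d(γ + ε²)·M)/c₀² ) + ε·M )`**.
Mechanism: each component `w_i = f^g(·,i)` solves the FLAT scalar equation `W·w_i − Nw_i = (D_1*D_1 f^g)(·,i)` (19a `covLap_flat_component`)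
and `D_1*D_1 f^g = D_{R^g}*D_{R^g} f^g − E` with `‖D_{R^g}*D_{R^g} f^g‖ = ‖D_R*D_R f‖ ≤ G` (module 2) and
`‖E‖ ≤ 2d|c₀|εD₁ + c₀²d(γ + ε²)M` on `B` (module 1 `norm_covLap_sub_flat_le` + module 3b `norm_flux_torus_le` + module 2's norm
invariances); (FG) bounds each `|w_i(x₀+e_μ) − w_i(x₀)|`; finally `(D_{R^g}f^g)(b₀) = c₀·(∂w(b₀) + (R^g_{b₀} − 1)f^g(x₀+e_μ))`
(module 1 `covD_flat_split`) and `‖(D_R f)(b₀)‖ = ‖(D_{R^g}f^g)(b₀)‖`.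
CONSUMER (the covariant twin of 19b): with `R ≍ θ·n(x₀)`, `ε = σ₁/(R+1)`, `γ = σ₂/(R+1)²` from the (SF) binder, `M`, `G` from the CLOSED
sup member and the source, and `D₁ ≤ X·Γ·n(x₀)e^{−δ′d}m` (the bootstrap quantity over the box), the term `K₂(R+1)·2d|c₀|εD₁` is
`2dK₂σ₁·|c₀|D₁` — the feedback coefficient `δ = 2dK₂σ₁√|Cp|` of module 3a's `bootstrap_scale_decay`; it closes iff `σ₁` is small.

WHAT IS CERTIFIED (kernel, 0 sorry, 0 def): §1 fibre-norm helpers (`abs_apply_le_norm`, `norm_le_sqrt_card_of_abs_le`,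
`norm_sub_delta_le_two`, `dist_dn_le_add_one`); §2 **`norm_covLap_defect_le_box`** (the `E`-bound on `B`); §3 **`covariant_fdiff_le_box`**
(the headline).  LOCATORS (shape only, nothing printed asserted; ABSOLUTE RULE): [Balaban1985BackgroundPropagators] (3.35) p. 396, Thm 3.1
(3.42) p. 397, p. 398 «invariant with respect to gauge transformations»; [Balaban1983RegularityDecay] Lemma 2.2 pp. 577–578 (print's device —
NOT reproduced).  Row D4: NO class change (critical-path width 0; D4 DISCHARGE NO DATE); NOT BetaPertH, NOT continuum, NOT Clay, NOT summit
progress.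
-/

open scoped BigOperators
open Finset

namespace Summit.QuantumFields.BalabanUV.Beta.CovariantGradientBox

open Literature.MathematicalPhysics.QuantumFieldTheory.Balaban1983to89
open Literature.MathematicalPhysics.QuantumFieldTheory.Balaban1983to89.B9Thm37Glue (covD covDT covD_apply covDT_apply)
open Literature.MathematicalPhysics.QuantumFieldTheory.Balaban1983to89.B9Thm37GluePU (bsrc btgt bsrc_apply btgt_apply)
open B5TorusCover (UT)
open B5Leibniz121 (up dn up_dn dist_up_le dist_dn_le)
open Summit.QuantumFields.BalabanUV.Beta.CovariantKato (sqrt_sum_sq_add_le sqrt_sum_sq_smul sqrt_sum_sq_Rm)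
open Summit.QuantumFields.BalabanUV.Beta.CovariantLaplacianFlatSplit (covD_flat_split norm_covLap_sub_flat_le)
open Summit.QuantumFields.BalabanUV.Beta.CovariantLaplacianGauge (gauge_col_orth covD_gauge norm_gauge_site norm_covD_gauge
  norm_covLap_gauge)
open Summit.QuantumFields.BalabanUV.Beta.CovariantFluxTorus (norm_flux_torus_le)
open Summit.QuantumFields.BalabanUV.Beta.MultiscaleRemainderLapTorus (sum_ite_bsrc_eq sum_ite_btgt_eq)
open Summit.QuantumFields.BalabanUV.Beta.MultiscaleGradientSource (covLap_flat_component)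

noncomputable section

/-! ## §1 Fibre-norm helpers -/

section Fibre

variable {Cp : Type} [Fintype Cp] [DecidableEq Cp]

omit [DecidableEq Cp] in
/-- A component is at most the fibre norm: `|v_i| ≤ √(Σ_j v_j²)`. [folklore] -/
theorem abs_apply_le_norm (v : Cp → ℝ) (i : Cp) : |v i| ≤ Real.sqrt (∑ j, v j ^ 2) := by
  rw [← Real.sqrt_sq_eq_abs]
  exact Real.sqrt_le_sqrt (Finset.single_le_sum (f := fun j => v j ^ 2) (fun j _ => sq_nonneg (v j)) (Finset.mem_univ i))

omit [DecidableEq Cp] in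
/-- Componentwise bound ⟹ fibre norm bound: `|v_i| ≤ A` for all `i` (`A ≥ 0`) ⟹ `√(Σ_i v_i²) ≤ √|Cp|·A`. [folklore] -/
theorem norm_le_sqrt_card_of_abs_le (v : Cp → ℝ) {A : ℝ} (hA : 0 ≤ A) (h : ∀ i, |v i| ≤ A) :
    Real.sqrt (∑ i, v i ^ 2) ≤ Real.sqrt (Fintype.card Cp) * A := by
  have h1 : ∑ i, v i ^ 2 ≤ (Fintype.card Cp : ℝ) * A ^ 2 := by
    calc ∑ i, v i ^ 2 ≤ ∑ _i : Cp, A ^ 2 := Finset.sum_le_sum fun i _ => by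
            rw [← sq_abs]; exact pow_le_pow_left₀ (abs_nonneg _) (h i) 2
      _ = (Fintype.card Cp : ℝ) * A ^ 2 := by rw [Finset.sum_const, Finset.card_univ, nsmul_eq_mul]
  calc Real.sqrt (∑ i, v i ^ 2) ≤ Real.sqrt ((Fintype.card Cp : ℝ) * A ^ 2) := Real.sqrt_le_sqrt h1
    _ = Real.sqrt (Fintype.card Cp) * A := by rw [Real.sqrt_mul (Nat.cast_nonneg _), Real.sqrt_sq hA]

/-- The crude deviation bound for an isometry: `‖(R − 1)v‖ ≤ 2‖v‖`. [folklore] -/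
theorem norm_sub_delta_le_two (R : Cp → Cp → ℝ) (hR : ∀ i j, ∑ k, R k i * R k j = if i = j then (1 : ℝ) else 0) (v : Cp → ℝ) :
    Real.sqrt (∑ i, (∑ j, (R i j - if i = j then (1 : ℝ) else 0) * v j) ^ 2) ≤ 2 * Real.sqrt (∑ j, v j ^ 2) := by
  have h : ∀ i, ∑ j, (R i j - if i = j then (1 : ℝ) else 0) * v j = (∑ j, R i j * v j) + -v i := fun i => by
    rw [CovariantLaplacianFlatSplit.sum_sub_delta_mul' R v i, sub_eq_add_neg]
  simp only [h]
  calc Real.sqrt (∑ i, ((∑ j, R i j * v j) + -v i) ^ 2)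
      ≤ Real.sqrt (∑ i, (∑ j, R i j * v j) ^ 2) + Real.sqrt (∑ i, (-v i) ^ 2) := sqrt_sum_sq_add_le _ _
    _ = Real.sqrt (∑ j, v j ^ 2) + Real.sqrt (∑ i, v i ^ 2) := by
        rw [sqrt_sum_sq_Rm R hR v]; congr 2; exact Finset.sum_congr rfl fun i _ => by rw [neg_sq]
    _ = 2 * Real.sqrt (∑ j, v j ^ 2) := by ring

end Fibre

section Torus

variable {d : ℕ} {N : Fin d → ℕ} [∀ i, NeZero (N i)]

/-- `dist(x − e_μ, x₀) ≤ dist(x, x₀) + 1`. [folklore] -/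
theorem dist_dn_le_add_one (x x₀ : UT N) (μ : Fin d) : dist (dn x μ) x₀ ≤ dist x x₀ + 1 := by
  have h1 := dist_triangle (dn x μ) x x₀
  have h2 := dist_dn_le x μ
  rw [dist_comm x (dn x μ)] at h2
  linarith

variable {Cp : Type} [Fintype Cp] [DecidableEq Cp]
  {c : UT N × Fin d → ℝ} {c₀ : ℝ} (hcc : ∀ b, c b = c₀)
  (Rg : UT N × Fin d → Cp → Cp → ℝ) (hRg1 : ∀ b i j, ∑ k, Rg b k i * Rg b k j = if i = j then (1 : ℝ) else 0)
  (x₀ : UT N) (R : ℕ) {ε γ : ℝ} (hε0 : 0 ≤ ε) (hγ0 : 0 ≤ γ)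
  (hε : ∀ b : UT N × Fin d, dist (bsrc b) x₀ ≤ 2 * R + 3 →
    ∀ v : Cp → ℝ, Real.sqrt (∑ i, (∑ j, (Rg b i j - if i = j then (1 : ℝ) else 0) * v j) ^ 2) ≤ ε * Real.sqrt (∑ j, v j ^ 2))
  (hγ : ∀ x ∈ univ.filter (fun x : UT N => dist x x₀ ≤ 2 * R + 2), ∀ μ (v : Cp → ℝ),
    Real.sqrt (∑ i, (∑ j, (Rg (dn x μ, μ) i j - Rg (x, μ) i j) * v j) ^ 2) ≤ γ * Real.sqrt (∑ j, v j ^ 2))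

include hcc hRg1 hε0 hγ0 hε hγ

/-! ## §2 The `E`-bound on the box in the good gauge -/

/-- **THE DEFECT `E = D_{R^g}*D_{R^g} − D_1*D_1` ON THE BOX**: for `x` with `dist(x,x₀) ≤ 2R+2` and a field `h` with `‖h(x)‖ ≤ M` and
`‖(D_{R^g}h)(b)‖ ≤ D₁` for the bonds starting in `{dist ≤ 2R+3}`:
`‖(D_{R^g}*D_{R^g} h − D_1*D_1 h)(x)‖ ≤ 2d|c₀|·ε·D₁ + c₀²d(γ + ε²)·M` (module 1 with the deviation profile `ε` near the box and `2` away,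
module 3b for the flux). [folklore] -/
theorem norm_covLap_defect_le_box (Rm₀ : UT N × Fin d → Cp → Cp → ℝ) (hflat : ∀ b i j, Rm₀ b i j = if i = j then (1 : ℝ) else 0)
    (h : UT N × Cp → ℝ) {M D₁ : ℝ}
    (x : UT N) (hx : x ∈ univ.filter (fun x : UT N => dist x x₀ ≤ 2 * R + 2))
    (hM : Real.sqrt (∑ i, h (x, i) ^ 2) ≤ M)
    (hD : ∀ b : UT N × Fin d, dist (bsrc b) x₀ ≤ 2 * R + 3 → Real.sqrt (∑ i, covD bsrc btgt c Rg h (b, i) ^ 2) ≤ D₁) :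
    Real.sqrt (∑ i, (covDT bsrc btgt c Rg (covD bsrc btgt c Rg h) (x, i) -
        covDT bsrc btgt c Rm₀ (covD bsrc btgt c Rm₀ h) (x, i)) ^ 2) ≤
      2 * d * |c₀| * ε * D₁ + c₀ ^ 2 * d * (γ + ε ^ 2) * M := by
  classical
  have hxd : dist x x₀ ≤ 2 * R + 2 := (Finset.mem_filter.mp hx).2
  -- the deviation profile: `ε` near the box, `2` elsewhere
  set εf : UT N × Fin d → ℝ := fun b => if dist (bsrc b) x₀ ≤ 2 * R + 3 then ε else 2 with hεf
  have hεf_all : ∀ b (v : Cp → ℝ), Real.sqrt (∑ i, (∑ j, (Rg b i j - if i = j then (1 : ℝ) else 0) * v j) ^ 2) ≤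
      εf b * Real.sqrt (∑ j, v j ^ 2) := by
    intro b v
    by_cases hb : dist (bsrc b) x₀ ≤ 2 * R + 3
    · simp only [hεf, hb, if_true]; exact hε b hb v
    · simp only [hεf, hb, if_false]; exact norm_sub_delta_le_two (Rg b) (hRg1 b) v
  -- the flux datum at `x` from module 3b
  have hMx : ∀ v : Cp → ℝ, Real.sqrt (∑ i, ((∑ b ∈ univ.filter (fun b : UT N × Fin d => btgt b = x),
        c b ^ 2 * ∑ j, (Rg b i j - if i = j then (1 : ℝ) else 0) * v j)
      + ∑ b ∈ univ.filter (fun b : UT N × Fin d => bsrc b = x), c b ^ 2 * ∑ k, (Rg b k i - if k = i then (1 : ℝ) else 0) * v k) ^ 2) ≤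
      c₀ ^ 2 * d * (γ + ε ^ 2) * Real.sqrt (∑ j, v j ^ 2) := fun v =>
    norm_flux_torus_le hcc Rg hRg1 x hε0 (fun μ v => hε (x, μ) (by rw [bsrc_apply]; linarith) v) (fun μ v => hγ x hx μ v) v
  have h1 := norm_covLap_sub_flat_le bsrc btgt c Rg Rm₀ hRg1 hflat εf hεf_all h x hMx
  refine h1.trans ?_
  -- the two first-order sums: every bond at `x` starts within `2R+3` of `x₀`
  have hT : ∑ b ∈ univ.filter (fun b : UT N × Fin d => btgt b = x), |c b| * εf b * Real.sqrt (∑ k, covD bsrc btgt c Rg h (b, k) ^ 2) ≤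
      d * |c₀| * ε * D₁ := by
    rw [Finset.sum_filter, sum_ite_btgt_eq x (fun b => |c b| * εf b * Real.sqrt (∑ k, covD bsrc btgt c Rg h (b, k) ^ 2))]
    have hb : ∀ μ, dist (bsrc (dn x μ, μ)) x₀ ≤ 2 * R + 3 := fun μ => by
      rw [bsrc_apply]; linarith [dist_dn_le_add_one x x₀ μ]
    calc ∑ μ, |c (dn x μ, μ)| * εf (dn x μ, μ) * Real.sqrt (∑ k, covD bsrc btgt c Rg h ((dn x μ, μ), k) ^ 2)
        ≤ ∑ _μ : Fin d, |c₀| * ε * D₁ := Finset.sum_le_sum fun μ _ => by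
          rw [hcc]; simp only [hεf, hb μ, if_true]
          exact mul_le_mul_of_nonneg_left (hD _ (hb μ)) (by positivity)
      _ = d * |c₀| * ε * D₁ := by rw [Finset.sum_const, Finset.card_univ, Fintype.card_fin, nsmul_eq_mul]; ring
  have hS : ∑ b ∈ univ.filter (fun b : UT N × Fin d => bsrc b = x), |c b| * εf b * Real.sqrt (∑ k, covD bsrc btgt c Rg h (b, k) ^ 2) ≤
      d * |c₀| * ε * D₁ := by
    rw [Finset.sum_filter, sum_ite_bsrc_eq x (fun b => |c b| * εf b * Real.sqrt (∑ k, covD bsrc btgt c Rg h (b, k) ^ 2))]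
    have hb : ∀ μ : Fin d, dist (bsrc (x, μ)) x₀ ≤ 2 * R + 3 := fun μ => by rw [bsrc_apply]; linarith
    calc ∑ μ, |c (x, μ)| * εf (x, μ) * Real.sqrt (∑ k, covD bsrc btgt c Rg h ((x, μ), k) ^ 2)
        ≤ ∑ _μ : Fin d, |c₀| * ε * D₁ := Finset.sum_le_sum fun μ _ => by
          rw [hcc]; simp only [hεf, hb μ, if_true]
          exact mul_le_mul_of_nonneg_left (hD _ (hb μ)) (by positivity)
      _ = d * |c₀| * ε * D₁ := by rw [Finset.sum_const, Finset.card_univ, Fintype.card_fin, nsmul_eq_mul]; ring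
  have hF : c₀ ^ 2 * d * (γ + ε ^ 2) * Real.sqrt (∑ i, h (x, i) ^ 2) ≤ c₀ ^ 2 * d * (γ + ε ^ 2) * M :=
    mul_le_mul_of_nonneg_left hM (by positivity)
  linarith [hT, hS, hF]

end Torus

/-! ## §3 THE BOX-LEVEL COVARIANT GRADIENT ESTIMATE -/

section Main

variable {d : ℕ} {N : Fin d → ℕ} [∀ i, NeZero (N i)] {Cp : Type} [Fintype Cp] [DecidableEq Cp]

/-- **THE BOX-LEVEL COVARIANT GRADIENT ESTIMATE IN A GOOD GAUGE.**  Unit torus `UT N`, constant weight `c ≡ c₀ ≠ 0`, column-orthonormal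
bond matrices `Rm`; a gauge `g` (sitewise column-orthonormal) with transformed transporters `R^g_b(i,j) = Σ_{k,l} g(b₋)_{ik}R_b(k,l)g(b₊)_{jl}`
and transformed field `f^g(x,i) = Σ_j g(x)_{ij}f(x,j)`; a centre `x₀`, `R ≥ 1`, `B = {dist(·,x₀) ≤ 2R+2}`.  ASSUME: the DEVIATION
`‖(R^g_b − 1)v‖ ≤ ε‖v‖` for bonds starting in `{dist(·,x₀) ≤ 2R+3}` and the LATTICE GRADIENT `‖(R^g_{(x−e_μ,μ)} − R^g_{(x,μ)})v‖ ≤ γ‖v‖`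
for `x ∈ B` (`ε, γ ≥ 0` — the (SF) datum at this box); the FLAT interior estimate (FG) at `(x₀, R)` for scalar functions with constants
`K₁, K₂ ≥ 0`; and the fibre-norm bounds `‖f(x)‖ ≤ M`, `‖(D_R*D_R f)(x)‖ ≤ G` for `x ∈ B`, `‖(D_R f)(b)‖ ≤ D₁` for bonds starting in
`{dist ≤ 2R+3}`.  THEN for every axis `μ`:
`‖(D_R f)((x₀,μ),·)‖ ≤ |c₀|·( √|Cp|·( K₁·M/(R+1) + K₂·(R+1)·(G + 2d|c₀|·ε·D₁ + c₀²d(γ+ε²)·M)/c₀² ) + ε·M )`.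
[cite: Balaban1985BackgroundPropagators, Thm 3.1 (3.42) p.397 + (3.35) p.396] [folklore] -/
theorem covariant_fdiff_le_box {c : UT N × Fin d → ℝ} {c₀ : ℝ} (hcc : ∀ b, c b = c₀) (hc₀ : c₀ ≠ 0)
    (Rm : UT N × Fin d → Cp → Cp → ℝ) (hRm : ∀ b i j, ∑ k, Rm b k i * Rm b k j = if i = j then (1 : ℝ) else 0)
    (g : UT N → Cp → Cp → ℝ) (hg : ∀ x i j, ∑ k, g x k i * g x k j = if i = j then (1 : ℝ) else 0)
    (Rg : UT N × Fin d → Cp → Cp → ℝ) (hRg : ∀ b i j, Rg b i j = ∑ k, g (bsrc b) i k * ∑ l, Rm b k l * g (btgt b) j l)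
    (x₀ : UT N) {R : ℕ} (hR : 1 ≤ R) {ε γ : ℝ} (hε0 : 0 ≤ ε) (hγ0 : 0 ≤ γ)
    (hε : ∀ b : UT N × Fin d, dist (bsrc b) x₀ ≤ 2 * R + 3 →
      ∀ v : Cp → ℝ, Real.sqrt (∑ i, (∑ j, (Rg b i j - if i = j then (1 : ℝ) else 0) * v j) ^ 2) ≤ ε * Real.sqrt (∑ j, v j ^ 2))
    (hγ : ∀ x ∈ univ.filter (fun x : UT N => dist x x₀ ≤ 2 * R + 2), ∀ μ (v : Cp → ℝ),
      Real.sqrt (∑ i, (∑ j, (Rg (dn x μ, μ) i j - Rg (x, μ) i j) * v j) ^ 2) ≤ γ * Real.sqrt (∑ j, v j ^ 2))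
    {K₁ K₂ : ℝ} (hK₁ : 0 ≤ K₁) (hK₂ : 0 ≤ K₂)
    (hFG : ∀ (w : UT N → ℝ) (M G : ℝ),
      (∀ x ∈ univ.filter (fun x : UT N => dist x x₀ ≤ 2 * R + 2), |w x| ≤ M) →
      (∀ x ∈ univ.filter (fun x : UT N => dist x x₀ ≤ 2 * R + 2),
        |((∑ b ∈ univ.filter (fun b : UT N × Fin d => btgt b = x), c b ^ 2) +
              ∑ b ∈ univ.filter (fun b : UT N × Fin d => bsrc b = x), c b ^ 2) * w x -
            ((∑ b ∈ univ.filter (fun b : UT N × Fin d => btgt b = x), c b ^ 2 * w (bsrc b)) +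
              ∑ b ∈ univ.filter (fun b : UT N × Fin d => bsrc b = x), c b ^ 2 * w (btgt b))| ≤ G) →
      ∀ μ, |w (up x₀ μ) - w x₀| ≤ K₁ * M / ((R : ℝ) + 1) + K₂ * ((R : ℝ) + 1) * G / c₀ ^ 2)
    (f fg : UT N × Cp → ℝ) (hfg : ∀ x i, fg (x, i) = ∑ j, g x i j * f (x, j))
    {M G D₁ : ℝ} (hD0 : 0 ≤ D₁)
    (hM : ∀ x ∈ univ.filter (fun x : UT N => dist x x₀ ≤ 2 * R + 2), Real.sqrt (∑ i, f (x, i) ^ 2) ≤ M)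
    (hG : ∀ x ∈ univ.filter (fun x : UT N => dist x x₀ ≤ 2 * R + 2),
      Real.sqrt (∑ i, covDT bsrc btgt c Rm (covD bsrc btgt c Rm f) (x, i) ^ 2) ≤ G)
    (hD : ∀ b : UT N × Fin d, dist (bsrc b) x₀ ≤ 2 * R + 3 → Real.sqrt (∑ i, covD bsrc btgt c Rm f (b, i) ^ 2) ≤ D₁)
    (μ : Fin d) :
    Real.sqrt (∑ i, covD bsrc btgt c Rm f ((x₀, μ), i) ^ 2) ≤
      |c₀| * (Real.sqrt (Fintype.card Cp) *
          (K₁ * M / ((R : ℝ) + 1) + K₂ * ((R : ℝ) + 1) * (G + 2 * d * |c₀| * ε * D₁ + c₀ ^ 2 * d * (γ + ε ^ 2) * M) / c₀ ^ 2)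
        + ε * M) := by
  classical
  set B := univ.filter (fun x : UT N => dist x x₀ ≤ 2 * R + 2) with hB
  -- the flat family and the transformed transporters
  set Rm₀ : UT N × Fin d → Cp → Cp → ℝ := fun _ i j => if i = j then (1 : ℝ) else 0 with hRm₀
  have hflat : ∀ b i j, Rm₀ b i j = if i = j then (1 : ℝ) else 0 := fun _ _ _ => rfl
  have hflat' : ∀ b k i, Rm₀ b k i = if k = i then (1 : ℝ) else 0 := fun _ _ _ => rfl
  have hRg1 : ∀ b i j, ∑ k, Rg b k i * Rg b k j = if i = j then (1 : ℝ) else 0 := gauge_col_orth bsrc btgt Rm g hRm hg Rg hRg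
  -- membership facts
  have hx₀B : x₀ ∈ B := Finset.mem_filter.mpr ⟨Finset.mem_univ _, by rw [dist_self]; positivity⟩
  have hR1' : (1 : ℝ) ≤ R := by exact_mod_cast hR
  have hupB : up x₀ μ ∈ B := Finset.mem_filter.mpr ⟨Finset.mem_univ _, by
    have h := dist_up_le x₀ μ
    rw [dist_comm] at h
    linarith⟩
  have hM0 : 0 ≤ M := (Real.sqrt_nonneg _).trans (hM x₀ hx₀B)
  have hG0 : 0 ≤ G := (Real.sqrt_nonneg _).trans (hG x₀ hx₀B)
  have hc2 : 0 < c₀ ^ 2 := by positivity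
  have hR1 : (0 : ℝ) < (R : ℝ) + 1 := by positivity
  -- the transformed bounds (gauge invariance of fibre norms)
  have hMg : ∀ x ∈ B, Real.sqrt (∑ i, fg (x, i) ^ 2) ≤ M := fun x hx => by
    rw [norm_gauge_site g hg f fg hfg x]; exact hM x hx
  have hDg : ∀ b : UT N × Fin d, dist (bsrc b) x₀ ≤ 2 * R + 3 → Real.sqrt (∑ i, covD bsrc btgt c Rg fg (b, i) ^ 2) ≤ D₁ :=
    fun b hb => by rw [norm_covD_gauge bsrc btgt c Rm g hg Rg hRg f fg hfg b]; exact hD b hb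
  have hGg : ∀ x ∈ B, Real.sqrt (∑ i, covDT bsrc btgt c Rg (covD bsrc btgt c Rg fg) (x, i) ^ 2) ≤ G := fun x hx => by
    rw [norm_covLap_gauge bsrc btgt c Rm g hg Rg hRg f fg hfg x]; exact hG x hx
  -- the source of the FLAT equation for `fg` on the box
  set G' : ℝ := G + 2 * d * |c₀| * ε * D₁ + c₀ ^ 2 * d * (γ + ε ^ 2) * M with hG'
  have hG'0 : 0 ≤ G' := by rw [hG']; positivity
  have hsrc : ∀ x ∈ B, Real.sqrt (∑ i, covDT bsrc btgt c Rm₀ (covD bsrc btgt c Rm₀ fg) (x, i) ^ 2) ≤ G' := by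
    intro x hx
    have hE := norm_covLap_defect_le_box hcc Rg hRg1 x₀ R hε0 hγ0 hε hγ Rm₀ hflat fg x hx (hMg x hx) hDg
    have e1 : Real.sqrt (∑ i, covDT bsrc btgt c Rm₀ (covD bsrc btgt c Rm₀ fg) (x, i) ^ 2) =
        Real.sqrt (∑ i, (covDT bsrc btgt c Rg (covD bsrc btgt c Rg fg) (x, i) +
          (covDT bsrc btgt c Rm₀ (covD bsrc btgt c Rm₀ fg) (x, i) - covDT bsrc btgt c Rg (covD bsrc btgt c Rg fg) (x, i))) ^ 2) := by
      congr 1; exact Finset.sum_congr rfl fun i _ => by ring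
    have e2 : Real.sqrt (∑ i, (covDT bsrc btgt c Rm₀ (covD bsrc btgt c Rm₀ fg) (x, i) -
        covDT bsrc btgt c Rg (covD bsrc btgt c Rg fg) (x, i)) ^ 2) =
        Real.sqrt (∑ i, (covDT bsrc btgt c Rg (covD bsrc btgt c Rg fg) (x, i) -
        covDT bsrc btgt c Rm₀ (covD bsrc btgt c Rm₀ fg) (x, i)) ^ 2) := by
      congr 1; exact Finset.sum_congr rfl fun i _ => by ring
    rw [e1]
    refine (sqrt_sum_sq_add_le _ _).trans ?_
    rw [e2, hG']
    linarith [hGg x hx, hE]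
  -- (FG) per component
  set Bnd : ℝ := K₁ * M / ((R : ℝ) + 1) + K₂ * ((R : ℝ) + 1) * G' / c₀ ^ 2 with hBnd
  have hBnd0 : 0 ≤ Bnd := by rw [hBnd]; positivity
  have hcomp : ∀ i, |fg (up x₀ μ, i) - fg (x₀, i)| ≤ Bnd := by
    intro i
    refine hFG (fun y => fg (y, i)) M G' (fun x hx => (abs_apply_le_norm (fun j => fg (x, j)) i).trans (hMg x hx)) ?_ μ
    intro x hx
    rw [← covLap_flat_component hflat' c fg x i]
    exact (abs_apply_le_norm (fun j => covDT bsrc btgt c Rm₀ (covD bsrc btgt c Rm₀ fg) (x, j)) i).trans (hsrc x hx)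
  -- the covariant difference at `b₀ = (x₀, μ)` in the gauge
  have hsplit : ∀ i, covD bsrc btgt c Rg fg ((x₀, μ), i) =
      c₀ * (fg (up x₀ μ, i) - fg (x₀, i)) + c₀ * ∑ j, (Rg (x₀, μ) i j - if i = j then (1 : ℝ) else 0) * fg (up x₀ μ, j) := by
    intro i
    rw [covD_flat_split bsrc btgt c Rg Rm₀ hflat fg (x₀, μ) i, MultiscaleGradientSource.covD_flat hflat' c fg (x₀, μ) i, hcc,
      btgt_apply, bsrc_apply]
  have hnorm : Real.sqrt (∑ i, covD bsrc btgt c Rg fg ((x₀, μ), i) ^ 2) ≤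
      |c₀| * (Real.sqrt (Fintype.card Cp) * Bnd) + |c₀| * (ε * M) := by
    simp only [hsplit]
    refine (sqrt_sum_sq_add_le _ _).trans (add_le_add ?_ ?_)
    · rw [sqrt_sum_sq_smul]
      exact mul_le_mul_of_nonneg_left (norm_le_sqrt_card_of_abs_le _ hBnd0 hcomp) (abs_nonneg _)
    · rw [sqrt_sum_sq_smul]
      refine mul_le_mul_of_nonneg_left ?_ (abs_nonneg _)
      have h1 := hε (x₀, μ) (by rw [bsrc_apply, dist_self]; positivity) (fun j => fg (up x₀ μ, j))
      exact h1.trans (mul_le_mul_of_nonneg_left (hMg _ hupB) hε0)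
  rw [← norm_covD_gauge bsrc btgt c Rm g hg Rg hRg f fg hfg (x₀, μ)]
  calc Real.sqrt (∑ i, covD bsrc btgt c Rg fg ((x₀, μ), i) ^ 2)
      ≤ |c₀| * (Real.sqrt (Fintype.card Cp) * Bnd) + |c₀| * (ε * M) := hnorm
    _ = |c₀| * (Real.sqrt (Fintype.card Cp) * Bnd + ε * M) := by ring

end Main

end

end Summit.QuantumFields.BalabanUV.Beta.CovariantGradientBox
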